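import Summits.CriticalPhenomena.Ising3DConformalLimit.Theses.PrecisionLaplacian
import Summits.CriticalPhenomena.Ising3DConformalLimit.Theses.HyperoctahedralRP
import Literature.MathematicalPhysics.QuantumFieldTheory.MirrorRPKernel
import Summits.CriticalPhenomena.Ising3DConformalLimit.Theorems.PrecisionLaplacianStableConeRPRigidityPeriodicTypeLiouville
import Summits.CriticalPhenomena.Ising3DConformalLimit.Theorems.PrecisionLaplacianStableConeRPRigidityPlanarRigidityLemma
import Summits.CriticalPhenomena.Ising3DConformalLimit.Theorems.PrecisionLaplacianStableConeRPRigidityXRayReduction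
import Summits.CriticalPhenomena.Ising3DConformalLimit.Theorems.PrecisionLaplacianStableConeRPRigidityStripTilingEntire
import Summits.CriticalPhenomena.Ising3DConformalLimit.Theorems.PrecisionLaplacianStableConeRPRigidityMellinAxialSymmetry
import Summits.CriticalPhenomena.Ising3DConformalLimit.Theorems.PrecisionLaplacianStableConeRPRigidityProbedXRayRP

/-!
# Line `entire-profile-null-growth` — crux `PrecisionLaplacian.StableConeRPRigidity` (stmt-CriticalPhenomena-4800)
# LEAD'S SKELETON (reshaped, 2026-08-16): axial Mellin probes instead of Riesz probes; def-free registered stubs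

Seven registered stubs `stub_*` (the only `sorry`s), each stated DEFINITION-FREE over Mathlib +
`Literature.MathematicalPhysics.QuantumFieldTheory.IsMirrorRPKernel` (= the crux's RP clause, definitionally), so
that every `--supports` file restates its stub verbatim; `def <Name> : Prop` mirrors of the same texts (generated
from one source, `work/gen_skeleton.py`) with consistency theorems `<name>_def : <Name> := stub_<name>`; the
`Registered.stub_*` aliases; the sorry-free compositions `nineMirrorRigidityBelowFour_of_stubs`,
`StableConeRPRigidity_of` (concludes the crux BY NAME) and the bonus `HRP2Rigidity_of` (item 1979).

THE LINE (idea card `entire-profile-null-growth`, planner skeleton `Lines/entire-profile-null-growth.lean` of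
2026-08-16T00:46Z).  Everything on the POTENTIAL-KERNEL side, general degree: `K > 0` continuous on `ℝ³ ∖ 0`,
homogeneous of degree `-β`, `0 < β < 4`, invariant and RP in the nine lattice mirrors (crux: `β = 3 - α ∈ (1,2]`;
item 1979: `β = 2Δ ∈ [1,2]`); `(α, Φ, potential equation)` are discarded at the first line of the composition.
* LEVER (S1–S4, unchanged from the planner): per mirror, RP + invariance + evenness make `t ↦ k(t n̂ + y)` the
  restriction of a holomorphic function on `{Re t > 0}` bounded by `k((Re t) n̂)` (S1, Bernstein–Widder);
  homogeneity turns the half-plane in the normal variable into the strip `{0 < Re ω < π/2}` of the complexified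
  polar angle; two OBLIQUE normals (`e₀`, `e₀+e₁`) have disjoint exceptional lines ⇒ the angular profile is
  ENTIRE of exponential type `β` (S2); a `π/2`-periodic entire function of type `β < 4` is constant (S3); hence
  PLANAR FOUR-LINE RIGIDITY (S4).
* TRANSFER `d = 3 ⇒ d = 2` (S5–S7, RESHAPED by the lead).  The planner probed with the radial RP kernels
  `‖x‖^{-γ}` (S5 = FILS78/Frank–Lieb RP of Riesz kernels: Bessel/Weyl integrals, far from Mathlib).  The lead
  probes instead with the AXIAL weights `|xᵢ|^{-δ}`, `0 < δ < 1`: for the four mirrors `n ⊥ eᵢ` the matrix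
  `[h(s_j - s_l)]` of any positive-definite `h` on `ℝ` Schur-multiplies the RP Gram matrix of `K` on the
  configurations `p_a + s_j eᵢ`, and `|s|^{-δ} = Γ(δ/2)⁻¹ ∫₀^∞ e^{-us²} u^{δ/2-1} du` is a monotone limit of
  Gaussian mixtures — so the PROBED X-RAY `y ↦ ∫ K(y + s eᵢ)|s|^{-δ} ds` is four-line RP (S5, elementary),
  continuous, positive, homogeneous of degree `-(β+δ-1) ∈ (-4,0)`, four-line invariant, hence RADIAL by S4
  (S6); and `δ ↦ ∫ K(ŷ + s eᵢ)|s|^{-δ} ds = 2·mellin (K(ŷ + · eᵢ)) (1-δ)` on `δ ∈ (max(0,1-β), 1)` determines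
  `K(ŷ + s eᵢ)` (Mellin = Fourier after `s = e^{-u}`, `Measure.ext_of_charFun`), so `K` is axially symmetric
  about every `eᵢ`, hence `O(3)`-invariant (S7).  Window: `δ < 1` (integrability at `s = 0`), `β + δ > 1`
  (at `∞`), `β + δ - 1 < 4` (S3) — non-empty iff `β < 4`; the crux sits at `β ∈ (1,2]`.

DISPROOF USED (`Cruxes/StableConeRPRigidity/Disproof.lean`, gen 2 v2, read in full 2026-08-16T01:00Z):
`not_invarianceOnlyRigidity` (RP load-bearing) — RP enters at S1 (Laplace/Bernstein), S5 (Schur) and through S5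
at S6; §W "diagonal mirrors load-bearing" — S4 uses the oblique pair `e₀, e₀+e₁`, S6 uses per axis the pair
`eⱼ, eⱼ+eₖ`; §W "`α < 2` essential, `1 ≤ α` unused" — window `0 < β = 3-α < 4`; §G (no continuation engine off the
seven-circle web) — moot, the off-web circles are integrated out by the X-ray and recovered by Mellin inversion
in the probe exponent; `of_HRP2Rigidity` — reversed: `NineMirrorRigidityBelowFour` gives both 4800 and 1979.
No `_false_without_` theorem or landed `Negative/` lemma exists for this crux (ledger crux ls, 2026-08-16T01:00Z).
-/

open MeasureTheory
open scoped BigOperators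

namespace Summit.CriticalPhenomena.Ising3DConformalLimit.Cruxes.StableConeRPRigidity.EntireProfileNullGrowth

open Summit.CriticalPhenomena.Ising3DConformalLimit.Theses

noncomputable section

/-! ## The seven stub STATEMENTS (definition-free texts; `def`s generated from the same source as the stubs) -/

/-- **S1 · per-mirror half-plane continuation (Bernstein–Widder; any real inner product space).**
For `K` continuous off `0`, even, bounded on every closed half-space `{⟪x, n̂⟫ ≥ t₀}` (`t₀ > 0`), invariant and
reflection positive for ONE mirror `n ≠ 0`, and any transverse offset `y ⊥ n`: `t ↦ K(t n̂ + y)` (`t > 0`) is the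
restriction of a function holomorphic on the open right half-plane, bounded there by `K((Re t) n̂)`.
Why true: the configurations `{s_a n̂} ∪ {s_a n̂ - y}` give the Gram matrix `[[A, B], [B, A]]`, so
`F_± (s) = K(s n̂) ± K(s n̂ + y)` are positive definite on the semigroup `((0,∞), +)`, continuous and bounded on
`[t₀, ∞)`; hence completely monotone (iterated differences alternate: `f - f(· + h)` stays in the class by a
Cauchy–Schwarz iteration), hence (Bernstein) real-analytic with Taylor radius `x₀` at `x₀`, which tiles
`{Re t > 0}`, with `|F_±(t)| ≤ F_±(Re t)`; `F = (F_+ - F_-)/2`.  HELD BY THE LEAD.  Size L. -/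
def HalfPlaneContinuation : Prop :=
  ∀ (E : Type) [NormedAddCommGroup E] [InnerProductSpace ℝ E] (K : E → ℝ) (n : E), n ≠ 0 →
      ContinuousOn K {0}ᶜ → (∀ x, K (-x) = K x) →
      (∀ t₀ : ℝ, 0 < t₀ → ∃ M : ℝ, ∀ x : E, t₀ ≤ inner ℝ x (‖n‖⁻¹ • n) → |K x| ≤ M) →
      (∀ x, K (((ℝ ∙ n)ᗮ).reflection x) = K x) → Literature.MathematicalPhysics.QuantumFieldTheory.IsMirrorRPKernel n K →
      ∀ y : E, inner ℝ y n = 0 →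
        ∃ F : ℂ → ℂ, DifferentiableOn ℂ F {t : ℂ | 0 < t.re} ∧
          (∀ t : ℝ, 0 < t → F t = ((K (t • ‖n‖⁻¹ • n + y) : ℝ) : ℂ)) ∧
          (∀ t : ℂ, 0 < t.re → ‖F t‖ ≤ K (t.re • ‖n‖⁻¹ • n))

/-- **S2 · strip tiling (one complex variable; the lever).**  A continuous `π`-periodic profile `κ`, symmetric about
`γ₁ + π/2` and `γ₂ + π/2` with `γ₂ - γ₁ ∉ (π/2)ℤ`, whose two traces `κ(γⱼ + π/2 - θ) = (cos θ)^{-β} Fⱼ(tan θ)` come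
from functions `Fⱼ` holomorphic on the right half-plane with `|Fⱼ(t)| ≤ C (Re t)^{-β}`, is the restriction of an
ENTIRE function of exponential type `≤ β`.  Why true: `tan` maps `{0 < Re θ < π/2}` onto `{Re t > 0}`, `cos θ`
stays in the right half-plane there, so `θ ↦ exp(-β Log cos θ) Fⱼ(tan θ)` continues `κ` to the open strips
between consecutive lines `Re ω ∈ γⱼ + (π/2)ℤ`; the two line families are disjoint, the continuations agree on
real intervals hence on overlaps (identity theorem) — entire; growth `|cos(a+ib)|·Re tan(a+ib) =
sin 2a/√(2(cos 2a + cosh 2b))` gives `|G| ≤ 2^β C cosh^β b / sin^β(2a)`, and every `Re ω` is at angular distance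
`≥ d₀ > 0` from one of the two families.  Size M. -/
def StripTilingEntire : Prop :=
  ∀ (κ : ℝ → ℝ) (β γ₁ γ₂ C : ℝ) (F₁ F₂ : ℂ → ℂ), 0 ≤ β →
      Continuous κ → (∀ ω, κ (ω + Real.pi) = κ ω) →
      (∀ ω, κ (2 * γ₁ + Real.pi - ω) = κ ω) → (∀ ω, κ (2 * γ₂ + Real.pi - ω) = κ ω) →
      (∀ k : ℤ, γ₂ - γ₁ ≠ (k : ℝ) * (Real.pi / 2)) →
      DifferentiableOn ℂ F₁ {t : ℂ | 0 < t.re} → DifferentiableOn ℂ F₂ {t : ℂ | 0 < t.re} →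
      (∀ t : ℂ, 0 < t.re → ‖F₁ t‖ ≤ C * t.re ^ (-β)) → (∀ t : ℂ, 0 < t.re → ‖F₂ t‖ ≤ C * t.re ^ (-β)) →
      (∀ θ : ℝ, 0 < θ → θ < Real.pi / 2 →
        ((κ (γ₁ + Real.pi / 2 - θ) : ℝ) : ℂ) = ((Real.cos θ ^ (-β) : ℝ) : ℂ) * F₁ ((Real.tan θ : ℝ) : ℂ)) →
      (∀ θ : ℝ, 0 < θ → θ < Real.pi / 2 →
        ((κ (γ₂ + Real.pi / 2 - θ) : ℝ) : ℂ) = ((Real.cos θ ^ (-β) : ℝ) : ℂ) * F₂ ((Real.tan θ : ℝ) : ℂ)) →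
      ∃ G : ℂ → ℂ, Differentiable ℂ G ∧ (∀ ω : ℝ, G ω = ((κ ω : ℝ) : ℂ)) ∧
        ∃ C' : ℝ, ∀ ω : ℂ, ‖G ω‖ ≤ C' * Real.exp (β * |ω.im|)

/-- **S3 · Liouville for periodic entire functions of small exponential type (mode extinction).**  An entire
`T`-periodic function with `|G(ω)| ≤ C e^{β|Im ω|}`, `0 ≤ β`, `βT < 2π`, is constant.  Why true: the Fourier
coefficient `a_m = T⁻¹ ∫₀ᵀ G(x+ib) e^{-2πim(x+ib)/T} dx` is independent of `b` (Cauchy; in tree: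
`Literature.Analysis.Complex.integral_mul_exp_eq_of_periodic` / `norm_coeff_le_of_periodic_entire`), and
`|a_m| ≤ C e^{|b|(β - 2π|m|/T)} → 0` (`b → ∓∞`), so `a_m = 0` for `m ≠ 0`; alternatively `G = H ∘ exp(2πi·/T)`
with `H` holomorphic on `ℂˣ`, `|H(ζ)| ≤ C max(|ζ|, |ζ|⁻¹)^{βT/2π}`, exponent `< 1` ⇒ removable at `0` and
constant.  Size M. -/
def PeriodicTypeLiouville : Prop :=
  ∀ (G : ℂ → ℂ) (T β C : ℝ), 0 < T → 0 ≤ β → β * T < 2 * Real.pi → Differentiable ℂ G →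
      (∀ ω : ℂ, G (ω + T) = G ω) → (∀ ω : ℂ, ‖G ω‖ ≤ C * Real.exp (β * |ω.im|)) →
      ∀ z w : ℂ, G z = G w

/-- **S4 · PLANAR FOUR-LINE RIGIDITY from S1–S3 (Euclidean bookkeeping of the `B₂ = D₄` arrangement).**
`S1 → S2 → S3 →` [a continuous positive kernel on `ℝ² ∖ 0`, homogeneous of degree `-β`, `0 < β < 4`, invariant
and RP in the four lines `x₁ = 0`, `x₂ = 0`, `x₁ = ± x₂`, is radial].  What to do: `k` is even
(`θ_{e₀} θ_{e₁} = -1`); slab bounds from homogeneity + continuity on the unit circle; `κ(ω) := k(cos ω e₀ +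
sin ω e₁)`; normal `e₀` (`γ₁ = 0`, offset `y = e₁`): `κ(π/2 - θ) = (cos θ)^{-β} k(tan θ e₀ + e₁)`; normal
`e₀ + e₁` (`γ₂ = π/4`, `n̂ = (e₀+e₁)/√2`, `y = (e₁-e₀)/√2`) likewise; `C = max(k n̂₁, k n̂₂)`; symmetries
`κ(π - ω) = κ ω`, `κ(3π/2 - ω) = κ ω`, period `π`; S2 ⇒ entire `G` of type `β`; `θ_{e₁} θ_{e₀-e₁}` is the quarter
turn so `G(ω + π/2) = G ω`; S3 with `T = π/2` (`βT < 2π ⇔ β < 4`) ⇒ `G` constant ⇒ `k y = k(e₀) ‖y‖^{-β}`.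
Size M. -/
def PlanarRigidityLemma : Prop :=
  (∀ (E : Type) [NormedAddCommGroup E] [InnerProductSpace ℝ E] (K : E → ℝ) (n : E), n ≠ 0 →
      ContinuousOn K {0}ᶜ → (∀ x, K (-x) = K x) →
      (∀ t₀ : ℝ, 0 < t₀ → ∃ M : ℝ, ∀ x : E, t₀ ≤ inner ℝ x (‖n‖⁻¹ • n) → |K x| ≤ M) →
      (∀ x, K (((ℝ ∙ n)ᗮ).reflection x) = K x) → Literature.MathematicalPhysics.QuantumFieldTheory.IsMirrorRPKernel n K →
      ∀ y : E, inner ℝ y n = 0 →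
        ∃ F : ℂ → ℂ, DifferentiableOn ℂ F {t : ℂ | 0 < t.re} ∧
          (∀ t : ℝ, 0 < t → F t = ((K (t • ‖n‖⁻¹ • n + y) : ℝ) : ℂ)) ∧
          (∀ t : ℂ, 0 < t.re → ‖F t‖ ≤ K (t.re • ‖n‖⁻¹ • n))) →
    (∀ (κ : ℝ → ℝ) (β γ₁ γ₂ C : ℝ) (F₁ F₂ : ℂ → ℂ), 0 ≤ β →
      Continuous κ → (∀ ω, κ (ω + Real.pi) = κ ω) →
      (∀ ω, κ (2 * γ₁ + Real.pi - ω) = κ ω) → (∀ ω, κ (2 * γ₂ + Real.pi - ω) = κ ω) →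
      (∀ k : ℤ, γ₂ - γ₁ ≠ (k : ℝ) * (Real.pi / 2)) →
      DifferentiableOn ℂ F₁ {t : ℂ | 0 < t.re} → DifferentiableOn ℂ F₂ {t : ℂ | 0 < t.re} →
      (∀ t : ℂ, 0 < t.re → ‖F₁ t‖ ≤ C * t.re ^ (-β)) → (∀ t : ℂ, 0 < t.re → ‖F₂ t‖ ≤ C * t.re ^ (-β)) →
      (∀ θ : ℝ, 0 < θ → θ < Real.pi / 2 →
        ((κ (γ₁ + Real.pi / 2 - θ) : ℝ) : ℂ) = ((Real.cos θ ^ (-β) : ℝ) : ℂ) * F₁ ((Real.tan θ : ℝ) : ℂ)) →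
      (∀ θ : ℝ, 0 < θ → θ < Real.pi / 2 →
        ((κ (γ₂ + Real.pi / 2 - θ) : ℝ) : ℂ) = ((Real.cos θ ^ (-β) : ℝ) : ℂ) * F₂ ((Real.tan θ : ℝ) : ℂ)) →
      ∃ G : ℂ → ℂ, Differentiable ℂ G ∧ (∀ ω : ℝ, G ω = ((κ ω : ℝ) : ℂ)) ∧
        ∃ C' : ℝ, ∀ ω : ℂ, ‖G ω‖ ≤ C' * Real.exp (β * |ω.im|)) →
    (∀ (G : ℂ → ℂ) (T β C : ℝ), 0 < T → 0 ≤ β → β * T < 2 * Real.pi → Differentiable ℂ G →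
      (∀ ω : ℂ, G (ω + T) = G ω) → (∀ ω : ℂ, ‖G ω‖ ≤ C * Real.exp (β * |ω.im|)) →
      ∀ z w : ℂ, G z = G w) →
    ∀ (β : ℝ) (k : EuclideanSpace ℝ (Fin 2) → ℝ), 0 < β → β < 4 →
      ContinuousOn k {0}ᶜ → (∀ y, y ≠ 0 → 0 < k y) →
      (∀ c : ℝ, 0 < c → ∀ y, k (c • y) = c ^ (-β) * k y) →
      (∀ ℓ : EuclideanSpace ℝ (Fin 2), (ℓ = EuclideanSpace.single 0 1 ∨ ℓ = EuclideanSpace.single 1 1 ∨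
        ℓ = EuclideanSpace.single 0 1 + EuclideanSpace.single 1 1 ∨ ℓ = EuclideanSpace.single 0 1 - EuclideanSpace.single 1 1) →
        (∀ y, k (((ℝ ∙ ℓ)ᗮ).reflection y) = k y) ∧ Literature.MathematicalPhysics.QuantumFieldTheory.IsMirrorRPKernel ℓ k) →
      ∀ (R : EuclideanSpace ℝ (Fin 2) ≃ₗᵢ[ℝ] EuclideanSpace ℝ (Fin 2)) (y : EuclideanSpace ℝ (Fin 2)), k (R y) = k y

/-- **S5 · reflection positivity of the axially probed X-ray (replaces the planner's Riesz probe; elementary).**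
For `K` continuous and positive off `0`, homogeneous of degree `-β`, RP for a mirror `n` ORTHOGONAL to the axis
`eᵢ`, and `0 < δ < 1 < β + δ`: the kernel `v ↦ ∫ K(v + s eᵢ) |s|^{-δ} ds` is again RP for `n` (finite sums over
the open half-space).  Why true: for points `p_a + s_j eᵢ` (still in the half-space since `eᵢ ⊥ n`; `θ_n` fixes
`eᵢ`) RP of `K` says `[K(p_a - θ p_b + (s_j - s_l) eᵢ)]` is PSD; the weight `h_ε(s_j - s_l)`,
`h_ε(s) = Γ(δ/2)⁻¹ ∫_ε^{1/ε} e^{-u s²} u^{δ/2-1} du ↑ |s|^{-δ}`, is PSD (Gaussians `e^{-u(s-s')²}` are positive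
definite on `ℝ`: `charFun` of a Gaussian / power series of the rank-one kernel `ss'`); Schur product
(`Matrix.PosSemidef.hadamard`) ⇒ `Σ_{ab} Σ_{jl} c_a c_b K(v_ab + (s_j-s_l)eᵢ) h_ε(s_j-s_l) ≥ 0`; grids
`s_j = jh` (`1 ≤ j ≤ N`) give Fejér sums `h Σ_k (1-|k|/N) G(kh)`, `N → ∞`, `h → 0` (Riemann sums of the
continuous integrable `G(s) = K(v+seᵢ)h_ε(s) = O(|s|^{-β-δ})`, `v = p_a - θp_b` has `⟪v,n⟫ > 0` so `v + seᵢ ≠ 0`),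
then `ε → 0` by monotone/dominated convergence (`|s|^{-δ}` integrable at `0` since `δ < 1`).  Size L. -/
def ProbedXRayRP : Prop :=
  ∀ (β δ : ℝ) (K : EuclideanSpace ℝ (Fin 3) → ℝ) (i : Fin 3) (n : EuclideanSpace ℝ (Fin 3)),
      0 < δ → δ < 1 → 1 < β + δ →
      ContinuousOn K {0}ᶜ → (∀ x, x ≠ 0 → 0 < K x) →
      (∀ c : ℝ, 0 < c → ∀ x, K (c • x) = c ^ (-β) * K x) →
      Literature.MathematicalPhysics.QuantumFieldTheory.IsMirrorRPKernel n K →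
      inner ℝ n (EuclideanSpace.single i (1:ℝ)) = 0 →
      ∀ (m : ℕ) (p : Fin m → EuclideanSpace ℝ (Fin 3)) (c : Fin m → ℝ), (∀ a, 0 < inner ℝ (p a) n) →
        0 ≤ ∑ a, ∑ b, c a * c b *
          ∫ s : ℝ, K (p a - ((ℝ ∙ n)ᗮ).reflection (p b) + s • EuclideanSpace.single i (1:ℝ)) * |s| ^ (-δ)

/-- **S6 · X-ray reduction (`S5 →` planar four-line rigidity `→` the probed axial X-rays of a nine-RP kernel are
radial about each lattice axis).**  For `K` continuous positive off `0`, homogeneous of degree `-β`, invariant and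
RP in the nine lattice mirrors, `0 < δ < 1`, `1 < β + δ < 5`: `∫ K(y + s eᵢ)|s|^{-δ} ds` depends only on `‖y‖` for
`y ⊥ eᵢ`, `y ≠ 0`.  Why true: with the coordinate embedding `ℝ² ≅ eᵢ^⊥`, `k(z) := ∫ K(ι z + s eᵢ)|s|^{-δ} ds`
converges (`K ≤ M‖x‖^{-β}`, `δ < 1`, `β + δ > 1`), is continuous on `ℝ² ∖ 0` (dominated convergence), positive,
homogeneous of degree `-(β + δ - 1) ∈ (-4, 0)` (`s = c s'`), invariant under the four square-lattice line
reflections (they lift to the mirrors `eⱼ, eₖ, eⱼ ± eₖ`, which fix `eᵢ`) and RP for them (S5 with `n ⊥ eᵢ`);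
planar rigidity makes `k` radial; planar isometries act transitively on circles (`Submodule.reflection_sub`).
Size M+. -/
def XRayReduction : Prop :=
  (∀ (β δ : ℝ) (K : EuclideanSpace ℝ (Fin 3) → ℝ) (i : Fin 3) (n : EuclideanSpace ℝ (Fin 3)),
      0 < δ → δ < 1 → 1 < β + δ →
      ContinuousOn K {0}ᶜ → (∀ x, x ≠ 0 → 0 < K x) →
      (∀ c : ℝ, 0 < c → ∀ x, K (c • x) = c ^ (-β) * K x) →
      Literature.MathematicalPhysics.QuantumFieldTheory.IsMirrorRPKernel n K →
      inner ℝ n (EuclideanSpace.single i (1:ℝ)) = 0 →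
      ∀ (m : ℕ) (p : Fin m → EuclideanSpace ℝ (Fin 3)) (c : Fin m → ℝ), (∀ a, 0 < inner ℝ (p a) n) →
        0 ≤ ∑ a, ∑ b, c a * c b *
          ∫ s : ℝ, K (p a - ((ℝ ∙ n)ᗮ).reflection (p b) + s • EuclideanSpace.single i (1:ℝ)) * |s| ^ (-δ)) →
    (∀ (β : ℝ) (k : EuclideanSpace ℝ (Fin 2) → ℝ), 0 < β → β < 4 →
      ContinuousOn k {0}ᶜ → (∀ y, y ≠ 0 → 0 < k y) →
      (∀ c : ℝ, 0 < c → ∀ y, k (c • y) = c ^ (-β) * k y) →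
      (∀ ℓ : EuclideanSpace ℝ (Fin 2), (ℓ = EuclideanSpace.single 0 1 ∨ ℓ = EuclideanSpace.single 1 1 ∨
        ℓ = EuclideanSpace.single 0 1 + EuclideanSpace.single 1 1 ∨ ℓ = EuclideanSpace.single 0 1 - EuclideanSpace.single 1 1) →
        (∀ y, k (((ℝ ∙ ℓ)ᗮ).reflection y) = k y) ∧ Literature.MathematicalPhysics.QuantumFieldTheory.IsMirrorRPKernel ℓ k) →
      ∀ (R : EuclideanSpace ℝ (Fin 2) ≃ₗᵢ[ℝ] EuclideanSpace ℝ (Fin 2)) (y : EuclideanSpace ℝ (Fin 2)), k (R y) = k y) →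
    ∀ (β δ : ℝ) (K : EuclideanSpace ℝ (Fin 3) → ℝ), 0 < δ → δ < 1 → 1 < β + δ → β + δ < 5 →
      ContinuousOn K {0}ᶜ → (∀ x, x ≠ 0 → 0 < K x) →
      (∀ c : ℝ, 0 < c → ∀ x, K (c • x) = c ^ (-β) * K x) →
      (∀ n : EuclideanSpace ℝ (Fin 3), (∃ i j : Fin 3, i ≠ j ∧ (n = EuclideanSpace.single i 1 ∨ n = EuclideanSpace.single i 1 + EuclideanSpace.single j 1 ∨
        n = EuclideanSpace.single i 1 - EuclideanSpace.single j 1)) →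
        (∀ x, K (((ℝ ∙ n)ᗮ).reflection x) = K x) ∧ Literature.MathematicalPhysics.QuantumFieldTheory.IsMirrorRPKernel n K) →
      ∀ (i : Fin 3) (y y' : EuclideanSpace ℝ (Fin 3)), inner ℝ y (EuclideanSpace.single i (1:ℝ)) = 0 →
        inner ℝ y' (EuclideanSpace.single i (1:ℝ)) = 0 → y ≠ 0 → ‖y‖ = ‖y'‖ →
        ∫ s : ℝ, K (y + s • EuclideanSpace.single i (1:ℝ)) * |s| ^ (-δ) =
          ∫ s : ℝ, K (y' + s • EuclideanSpace.single i (1:ℝ)) * |s| ^ (-δ)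

/-- **S7 · Mellin uniqueness in the probe exponent, and generation of `O(3)`.**  If `K` is continuous positive off
`0`, homogeneous of degree `-β < 0`, nine-mirror invariant, and for every `δ` with `0 < δ`, `1 - β < δ < 1` the
probed X-rays `∫ K(y + s eᵢ)|s|^{-δ} ds` are radial about every axis, then `K` is `O(3)`-invariant.  Why true:
for unit `ŷ ⊥ eᵢ`, `f_ŷ(s) := K(ŷ + s eᵢ)` is even in `s` (mirror `eᵢ`), continuous, bounded, `O(s^{-β})`, so
`∫ f_ŷ |s|^{-δ} = 2·mellin f_ŷ (1-δ)` and `mellin f_ŷ` is holomorphic on `0 < Re z < β`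
(`mellin_differentiableAt_of_isBigO_rpow`); equality for `z ∈ (0, min(1,β))` propagates to the strip
(`AnalyticOnNhd.eqOn_of_preconnected_of_frequently_eq`), on a vertical line `mellin = 𝓕` of
`u ↦ e^{-σu} f(e^{-u})` (`mellin_eq_fourier`), and finite positive measures with equal `charFun` coincide
(`Measure.ext_of_charFun`) ⇒ `f_ŷ = f_ŷ'` a.e. ⇒ everywhere (continuity).  Homogeneity then gives invariance of
`K` under the isometries fixing `eᵢ`, for each `i`; `K(x₀,x₁,x₂) = K(√(x₀²+x₁²),0,x₂) = K(0,0,‖x‖)`, so `K` is a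
function of `‖x‖` (`Disproof.isotropic_iff_norm`).  Size M/L. -/
def MellinAxialSymmetry : Prop :=
  ∀ (β : ℝ) (K : EuclideanSpace ℝ (Fin 3) → ℝ), 0 < β →
      ContinuousOn K {0}ᶜ → (∀ x, x ≠ 0 → 0 < K x) →
      (∀ c : ℝ, 0 < c → ∀ x, K (c • x) = c ^ (-β) * K x) →
      (∀ n : EuclideanSpace ℝ (Fin 3), (∃ i j : Fin 3, i ≠ j ∧ (n = EuclideanSpace.single i 1 ∨ n = EuclideanSpace.single i 1 + EuclideanSpace.single j 1 ∨
        n = EuclideanSpace.single i 1 - EuclideanSpace.single j 1)) →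
        ∀ x, K (((ℝ ∙ n)ᗮ).reflection x) = K x) →
      (∀ δ : ℝ, 0 < δ → 1 - β < δ → δ < 1 →
        ∀ (i : Fin 3) (y y' : EuclideanSpace ℝ (Fin 3)), inner ℝ y (EuclideanSpace.single i (1:ℝ)) = 0 →
          inner ℝ y' (EuclideanSpace.single i (1:ℝ)) = 0 → y ≠ 0 → ‖y‖ = ‖y'‖ →
          ∫ s : ℝ, K (y + s • EuclideanSpace.single i (1:ℝ)) * |s| ^ (-δ) =
            ∫ s : ℝ, K (y' + s • EuclideanSpace.single i (1:ℝ)) * |s| ^ (-δ)) →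
      ∀ (R : EuclideanSpace ℝ (Fin 3) ≃ₗᵢ[ℝ] EuclideanSpace ℝ (Fin 3)) (x : EuclideanSpace ℝ (Fin 3)), K (R x) = K x

/-! ## Registered stubs still OPEN (the only `sorry`s of the line; statements verbatim = the `def`s above).
Landed stubs are IMPORTED from their accepted Theorems files (same FQN): `stub_periodicTypeLiouville` (p74801), `stub_planarRigidityLemma` (p74659), `stub_xRayReduction` (p75233), `stub_stripTilingEntire` (p75592), `stub_mellinAxialSymmetry` (p75622), `stub_probedXRayRP` (p75941). -/

/-- Registered stub `stub_halfPlaneContinuation` — S1 · per-mirror half-plane continuation (Bernstein–Widder; any real inner product space). (statement = `HalfPlaneContinuation`, verbatim). -/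
theorem stub_halfPlaneContinuation :
    ∀ (E : Type) [NormedAddCommGroup E] [InnerProductSpace ℝ E] (K : E → ℝ) (n : E), n ≠ 0 →
      ContinuousOn K {0}ᶜ → (∀ x, K (-x) = K x) →
      (∀ t₀ : ℝ, 0 < t₀ → ∃ M : ℝ, ∀ x : E, t₀ ≤ inner ℝ x (‖n‖⁻¹ • n) → |K x| ≤ M) →
      (∀ x, K (((ℝ ∙ n)ᗮ).reflection x) = K x) → Literature.MathematicalPhysics.QuantumFieldTheory.IsMirrorRPKernel n K →
      ∀ y : E, inner ℝ y n = 0 →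
        ∃ F : ℂ → ℂ, DifferentiableOn ℂ F {t : ℂ | 0 < t.re} ∧
          (∀ t : ℝ, 0 < t → F t = ((K (t • ‖n‖⁻¹ • n + y) : ℝ) : ℂ)) ∧
          (∀ t : ℂ, 0 < t.re → ‖F t‖ ≤ K (t.re • ‖n‖⁻¹ • n)) := by
  sorry

/-! ## Consistency: each named statement IS its registered stub (definitionally) -/

theorem halfPlaneContinuation_def : HalfPlaneContinuation := stub_halfPlaneContinuation
theorem stripTilingEntire_def : StripTilingEntire := stub_stripTilingEntire
theorem periodicTypeLiouville_def : PeriodicTypeLiouville := stub_periodicTypeLiouville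
theorem planarRigidityLemma_def : PlanarRigidityLemma := stub_planarRigidityLemma
theorem probedXRayRP_def : ProbedXRayRP := stub_probedXRayRP
theorem xRayReduction_def : XRayReduction := stub_xRayReduction
theorem mellinAxialSymmetry_def : MellinAxialSymmetry := stub_mellinAxialSymmetry


/-! ## The compositions (kernel-checked, no `sorry` of their own) -/

/-- The packaged target `C⁺` of the transfer: nine-mirror RP rigidity for EVERY degree `0 < β < 4` (no stable
cone, no `Φ`, no potential equation). -/
def NineMirrorRigidityBelowFour : Prop :=
  ∀ (β : ℝ) (K : EuclideanSpace ℝ (Fin 3) → ℝ), 0 < β → β < 4 →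
    ContinuousOn K {0}ᶜ → (∀ x, x ≠ 0 → 0 < K x) →
    (∀ c : ℝ, 0 < c → ∀ x, K (c • x) = c ^ (-β) * K x) →
    (∀ n : EuclideanSpace ℝ (Fin 3), (∃ i j : Fin 3, i ≠ j ∧ (n = EuclideanSpace.single i 1 ∨
        n = EuclideanSpace.single i 1 + EuclideanSpace.single j 1 ∨
        n = EuclideanSpace.single i 1 - EuclideanSpace.single j 1)) →
      (∀ x, K (((ℝ ∙ n)ᗮ).reflection x) = K x) ∧
        Literature.MathematicalPhysics.QuantumFieldTheory.IsMirrorRPKernel n K) →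
    ∀ (R : EuclideanSpace ℝ (Fin 3) ≃ₗᵢ[ℝ] EuclideanSpace ℝ (Fin 3)) (x : EuclideanSpace ℝ (Fin 3)), K (R x) = K x

/-- `C⁺` from the seven stub statements: S4 (fed S1–S3) is planar rigidity; for each probe exponent
`δ ∈ (max(0, 1-β), 1)` S6 (fed S5 and S4) makes the probed axial X-rays radial; S7 concludes. -/
theorem nineMirrorRigidityBelowFour_of_stubs
    (h₁ : HalfPlaneContinuation) (h₂ : StripTilingEntire) (h₃ : PeriodicTypeLiouville) (h₄ : PlanarRigidityLemma)
    (h₅ : ProbedXRayRP) (h₆ : XRayReduction) (h₇ : MellinAxialSymmetry) : NineMirrorRigidityBelowFour := by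
  intro β K hβ0 hβ4 hKc hKp hhom hmir
  have hplanar := h₄ h₁ h₂ h₃
  refine h₇ β K hβ0 hKc hKp hhom (fun n hn => (hmir n hn).1) ?_
  intro δ hδ0 hδβ hδ1
  exact h₆ h₅ hplanar β δ K hδ0 hδ1 (by linarith) (by linarith) hKc hKp hhom hmir

/-- Alias of the crux used as the conclusion of `StableConeRPRigidity_of_stubs`, so that exactly one theorem of
this file (`StableConeRPRigidity_of`, hypotheses = the registered stubs by name) concludes the crux decl by name. -/
abbrev CruxStatement : Prop :=
  _root_.Summit.CriticalPhenomena.Ising3DConformalLimit.Theses.PrecisionLaplacian.StableConeRPRigidity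

/-- THE COMPOSITION for the crux: unbundle the crux's binders, discard `(Φ, potential equation)`, set
`β := 3 - α ∈ (1,2] ⊂ (0,4)`, apply `C⁺`. -/
theorem StableConeRPRigidity_of_stubs
    (h₁ : HalfPlaneContinuation) (h₂ : StripTilingEntire) (h₃ : PeriodicTypeLiouville) (h₄ : PlanarRigidityLemma)
    (h₅ : ProbedXRayRP) (h₆ : XRayReduction) (h₇ : MellinAxialSymmetry) : CruxStatement := by
  show PrecisionLaplacian.StableConeRPRigidity
  intro α Φ K h1 h2 _hc _hnn _hpos _hev hKc hKp hhom _hpot hmir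
  have hhom' : ∀ c : ℝ, 0 < c → ∀ x, K (c • x) = c ^ (-(3 - α)) * K x := by
    intro c hc' x
    rw [show (-(3 - α) : ℝ) = α - 3 by ring]
    exact hhom c hc' x
  exact nineMirrorRigidityBelowFour_of_stubs h₁ h₂ h₃ h₄ h₅ h₆ h₇ (3 - α) K (by linarith) (by linarith)
    hKc hKp hhom' hmir

/-- BONUS (item stmt-CriticalPhenomena-1979 of route HyperoctahedralRP, same stubs): `β := 2Δ ∈ [1,2] ⊂ (0,4)`. -/
theorem HRP2Rigidity_of_stubs
    (h₁ : HalfPlaneContinuation) (h₂ : StripTilingEntire) (h₃ : PeriodicTypeLiouville) (h₄ : PlanarRigidityLemma)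
    (h₅ : ProbedXRayRP) (h₆ : XRayReduction) (h₇ : MellinAxialSymmetry) :
    HyperoctahedralRP.HRP2Rigidity := by
  intro Δ K hΔ1 hΔ2 hKc hKp hhom hmir
  exact nineMirrorRigidityBelowFour_of_stubs h₁ h₂ h₃ h₄ h₅ h₆ h₇ (2 * Δ) K (by linarith) (by linarith)
    hKc hKp hhom hmir

namespace Registered

/-- Aliases of the seven statements keyed by the registered stub names. -/
abbrev stub_halfPlaneContinuation : Prop := HalfPlaneContinuation
abbrev stub_stripTilingEntire : Prop := StripTilingEntire
abbrev stub_periodicTypeLiouville : Prop := PeriodicTypeLiouville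
abbrev stub_planarRigidityLemma : Prop := PlanarRigidityLemma
abbrev stub_probedXRayRP : Prop := ProbedXRayRP
abbrev stub_xRayReduction : Prop := XRayReduction
abbrev stub_mellinAxialSymmetry : Prop := MellinAxialSymmetry

end Registered

/-- THE SKELETON THEOREM: the OPEN registered stubs (hypotheses, by name) together with the LANDED ones (imported
theorems) imply the crux `PrecisionLaplacian.StableConeRPRigidity` BY NAME. -/
theorem StableConeRPRigidity_of (h_halfPlaneContinuation : Registered.stub_halfPlaneContinuation) :
    _root_.Summit.CriticalPhenomena.Ising3DConformalLimit.Theses.PrecisionLaplacian.StableConeRPRigidity :=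
  StableConeRPRigidity_of_stubs h_halfPlaneContinuation stub_stripTilingEntire stub_periodicTypeLiouville stub_planarRigidityLemma stub_probedXRayRP stub_xRayReduction stub_mellinAxialSymmetry

/-- Wiring check: the registered stubs feed `StableConeRPRigidity_of` as stated (becomes a proof of the crux once
the remaining `sorry`s are discharged). -/
example : _root_.Summit.CriticalPhenomena.Ising3DConformalLimit.Theses.PrecisionLaplacian.StableConeRPRigidity :=
  StableConeRPRigidity_of stub_halfPlaneContinuation

/-- Item 1979 modulo the same seven stubs. -/
theorem HRP2Rigidity_of :
    _root_.Summit.CriticalPhenomena.Ising3DConformalLimit.Theses.HyperoctahedralRP.HRP2Rigidity :=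
  HRP2Rigidity_of_stubs stub_halfPlaneContinuation stub_stripTilingEntire stub_periodicTypeLiouville
    stub_planarRigidityLemma stub_probedXRayRP stub_xRayReduction stub_mellinAxialSymmetry

end

end Summit.CriticalPhenomena.Ising3DConformalLimit.Cruxes.StableConeRPRigidity.EntireProfileNullGrowth
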